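import Mathlib
import Summits.Ventures.FusionMHD.Models.CerfonFreidbergIterLikeQHalfResDefs
import HarnessLib

/-!
# Ventures/FusionMHD — Models/CerfonFreidbergIterLikeQHalfResPanels5.lean: KERNEL CHECK of the resistive-register certificates of panel(s) 6, 7 (of 32)
# at `ψ_N = 1/2` of THE Cerfon–Freidberg ITER-like instance

HONEST FRAMING (LADDER-GRIDFUSION three columns; CF rung; rider «D_R at ψ_N = 1/2»).  One `decide +kernel` (≈ 60–90 s): for each listed panel the obligation
`CFIterLike.QHalfRes.ResCert.ok` (`Models/CerfonFreidbergIterLikeQHalfResDefs.lean`) — the Taylor-model run of `progR = progM ++ block3R` over ★ #117's parameter box is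
ACCEPTED and the kernel's two panel-integral enclosures (`g_AG`, `g_W` along the approximant) lie inside the claimed integers (compiled `#eval` of the same functions, slack
one unit of `2⁻⁶⁰`; float truth inside every panel, `genqm/truthR.json`).  MODELLED: analytic Cerfon–Freidberg family; nothing about a device or stability.
No `native_decide`.  Typer/prover: gridfusion-model-7 (g7), 2026-08-28.  Citations: Zheng 2015 §3.2 (3.42) [Zheng2015];
Mahboubi–Melquiond–Sibut-Pinote 2016 §3.2 Lemma 3 [MahboubiMelquiondSibutpinote2016].
-/

namespace Summit.Ventures.FusionMHD.Models.CFIterLike.QHalfRes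

/-- Resistive-register certificate data of panel(s) 6, 7. [instance data] -/
def resCert5 : List ResCert := [
  { j := 6, cand1 := [126743900120210931712, 380833473018928562176, 1666882981515048255488, 4779887472754209849344, 14876079706830249394176, 40114630039015809613824, 105123249502923612225536, 250235918450350190755840, 232830255899480422350848, -1885310705121875168591872, 1046956547654696253637263360, 5454542091213651164312633344, -1262110342642620776310485549056],
    cand2 := [140702960883855409152, 271388716073036480512, 1188284140132528553984, 3469996211904075268096, 11242118064341717614592, 31974125985622445260800, 89104911062398247370752, 231674882415974535921664, 693603549213226916904960, 5968490420922929733697536, -547386804145225684513456128, -6773942464320943401862168576, 927426109802073117470845042688],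
    deg := 10, e1 := 42, e2 := 42, glo := 4120614743779284, ghi := 4120615162033467, wlo := 168037227238723941, whi := 168037242595245232 },
  { j := 7, cand1 := [140434120266580410368, 501045001336953044992, 2216079086867641794560, 7104626892502204416000, 22991297996876188483584, 66026426889737410183168, 177975872168225973207040, 435062914464377487753216, 844036306372175310356480, -8818286479686622657904640, 303221231164222683962408960, 16731373321909618361149423616, -332415501646916375004152070144],
    cand2 := [150461952433914511360, 357364873123426205696, 1590663105860603478016, 5250767401134828027904, 17837164812596626325504, 54654538391082468638720, 160478928844752752214016, 446039405837738789830656, 749548054430011889811456, -9319581023398861698236416, 1332165936372729158087737344, 16927403803660120066560622592, -1604223857064749171020927074304],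
    deg := 10, e1 := 42, e2 := 42, glo := 4286220173991350, ghi := 4286220581356515, wlo := 177844151590469880, whi := 177844166698125263 }]

/-- **KERNEL CHECK** of the two resistive registers on panel(s) 6, 7. -/
theorem resCert5_ok : CFIterLike.QHalfRes.resCert5.all ResCert.ok = true := by
  decide +kernel

end Summit.Ventures.FusionMHD.Models.CFIterLike.QHalfRes
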